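import Mathlib
import HarnessLib
import Summits.HubbardSuperconductivity.HubbardSuperconductivity.Theorems.KLProgrammeKLRegimeSplitPredicatesV3

/-!
# Route `KLProgramme` — crux K3 split: INHABITANTS of the four constant packages with their well-formedness PROVED
# (planner g9 V3-R (C-vii); cell gate-hubbard-kl, seat p1 = C1 lead, g5)

The generic children quantify `∃ G, G.WF ∧ ∀ P, P.WF → ∃ Q, Q.WF ∧ ∀ R, R.WF → …` (`KLProgrammeKLRegimeSplitGeneric`).  For the
tribunal's non-vacuity reading this file exhibits one inhabitant of each record of `KLProgrammeKLRegimeSplitConsts` satisfying its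
well-formedness predicate: `klG₀ : GeoConsts` (all sizes `0`, rate `θ = 1/2`), `klP₀ : SplitConsts` (`Klam = 1`), `klQ₀ : EngConsts`,
`klR₀ : RenConsts` — so none of the four `WF` predicates is contradictory and every `∀ P, P.WF → …` / `∀ R, R.WF → …` binder of
the children has an instance.  (These are NOT the constants of the theorem; the engine's `G`, child 1's `P`, … are produced by the
provers.)  Nothing about the model is asserted.
-/

noncomputable section

namespace Summit.HubbardSuperconductivity.HubbardSuperconductivity.Theorems.KLRegimeSplit

set_option linter.dupNamespace false -- summit = problem name (single-conjunct summit), D-0017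

open Finset

/-- A well-formed inhabitant of `GeoConsts` (all sizes `0`, `θ = 1/2`). -/
def klG₀ : GeoConsts where
  atop := fun _ => 0
  abot := fun _ => 0
  blo := 0
  bhi := 0
  cloc := 0
  θ := 1 / 2
  a := fun _ => 0
  ζ := fun _ => 0
  Z := 0
  aplus := 0
  ppGain := fun _ _ => 0
  phGain := fun _ _ => 0
  CF := 0
  cE4 := 0
  S := fun _ => 0
  Bf := 0
  SL := 0

/-- A well-formed inhabitant of `SplitConsts` (`Klam = 1`). -/
def klP₀ : SplitConsts where
  Klam := 1
  C_W := 0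
  Cd := 0
  t₀ := 0

/-- A well-formed inhabitant of `EngConsts` (all `0`). -/
def klQ₀ : EngConsts where
  CE := 0
  CR := 0
  c0 := 0
  cE4 := 0
  S' := fun _ => 0
  Bf := 0
  SL := 0
  CL := fun _ _ => 0
  L0 := fun _ => 0
  M0 := fun _ _ => 0

/-- A well-formed inhabitant of `RenConsts` (all `0`). -/
def klR₀ : RenConsts where
  cr := 0
  cz := 0
  Gfr := fun _ => 0

/-- `klG₀` is well formed. -/
theorem klG₀_WF : klG₀.WF := by
  refine ⟨fun _ => le_rfl, fun _ => le_rfl, le_rfl, le_rfl, le_rfl, by norm_num [klG₀], by norm_num [klG₀], fun _ => le_rfl,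
    fun _ => le_rfl, fun N => ?_, le_rfl, fun _ _ => le_rfl, fun _ _ => le_rfl, le_rfl, fun ρ N _ => ?_, fun ρ t N _ => ?_,
    le_rfl, fun _ => le_rfl, le_rfl, le_rfl⟩
  · simp [klG₀]
  · simp [klG₀]
  · simp [klG₀]

/-- `klP₀` is well formed. -/
theorem klP₀_WF : klP₀.WF := ⟨le_rfl, le_rfl, le_rfl⟩

/-- `klQ₀` is well formed. -/
theorem klQ₀_WF : klQ₀.WF := ⟨le_rfl, le_rfl, le_rfl, le_rfl, fun _ => le_rfl, le_rfl, le_rfl, fun _ _ => le_rfl⟩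

/-- `klR₀` is well formed. -/
theorem klR₀_WF : klR₀.WF := ⟨le_rfl, le_rfl, fun _ => le_rfl⟩

/-- Hence each well-formedness predicate is satisfiable. -/
theorem consts_WF_nonempty :
    (∃ G : GeoConsts, G.WF) ∧ (∃ P : SplitConsts, P.WF) ∧ (∃ Q : EngConsts, Q.WF) ∧ (∃ R : RenConsts, R.WF) :=
  ⟨⟨klG₀, klG₀_WF⟩, ⟨klP₀, klP₀_WF⟩, ⟨klQ₀, klQ₀_WF⟩, ⟨klR₀, klR₀_WF⟩⟩

end Summit.HubbardSuperconductivity.HubbardSuperconductivity.Theorems.KLRegimeSplit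

end
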